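import Mathlib
import Literature.Analysis.FluidPDE.ClassicalSolution
import Literature.Analysis.FluidPDE.LerayHopf
import Literature.Analysis.FluidPDE.DissipationWavenumber
import HarnessLib

/-!
# RootDecompIntermittency — crux X₁ `NoThinFrontierBlowup` (stmt-NavierStokesRegularity-27233), stub `stub_frontierL2Apriori`

Registered stub F1 of the writer g11 first-prover skeleton `NoThinFrontierBlowup_line.lean` (lens-1 g3
INTERMITTENCY LADDER; «size M; PROVABLE NOW — frontier a-priori bound Λ ∈ L²(t₀,T)»), PROVED here verbatim:
**a 1-thin frontier makes the Cheskidov–Shvydkoy dissipation wavenumber square-integrable in time.**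
If at every time `t ∈ (t₀,T)` every FRONTIER level `j` of the slice `u t` (saturated at `j`, unsaturated
above `j`) is 1-thin, `‖Δ̇_j u(t)‖_∞ ≤ C 2^{j} ‖Δ̇_j u(t)‖₂`, then `∫_{t₀}^T Λ_{c₀,ν}(u(t))² dt < ∞` for every
Leray–Hopf solution on `ℝ³ × [0,T)` (`ν > 0`).

Proof (Cheskidov–Shvydkoy 2014, proof of Lemma 4.1 with the thin Bernstein step in place of the full one):
at a.e. time the slice is `L²` with a weak gradient `G t` of finite dissipation `D(t) = ∫|G t|²` and
`Λ(t) < ∞`, so either no level is saturated (`Λ = 1`) or there is a TOP saturated level `Q` — a frontier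
level, `Λ ≤ 2^Q`; saturation, thinness and the `L²` REVERSE BERNSTEIN inequality for Sobolev slices
(`‖Δ̇_Q v‖₂ ≤ C₂ 2^{−Q} D^{1/2}`, proved here from the tree's distribution-level reverse Bernstein
inequality exactly as in `exists_eLpNorm_top_blockFn_le_two_rpow_mul_dissipation`, minus the `L² → L^∞`
Bernstein factor) give `c₀ν·2^Q ≤ C 2^Q · C₂ 2^{−Q} D^{1/2}`, i.e. `(c₀ν)² Λ² ≤ (C C₂)² D`; hence
`Λ(t)² ≤ 1 + K·D(t)` a.e. and `∫_{t₀}^T Λ² ≤ (T − t₀) + K·E(u 0)/ν < ∞` by the energy inequality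
(`IsLerayHopfOn.exists_measurable_dissipation`). The classical-solution hypothesis is idle.
Decoration toward S (an a-priori stratum of a crux whose content is the open deficit lemma
`stub_thickBelowThinDeficit`); Navier–Stokes regularity is NOT proved by anything here (rung 0).
-/

noncomputable section

-- the summit and its single sub-problem share the name (CONVENTIONS §1), as in every Theorems file
set_option linter.dupNamespace false

open MeasureTheory Filter Set Function
open scoped ENNReal NNReal SchwartzMap LineDeriv
open Literature.Analysis.FluidPDE Literature.Analysis.FunctionSpaces

namespace Summit.NavierStokesRegularity.NavierStokesRegularity.Theorems.NoThinFrontierBlowup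

/-! ### The `L²` reverse Bernstein inequality for Sobolev slices on `ℝ³` -/

/-- **Reverse Bernstein in `L²` against the dissipation**: there is an absolute `C` such that for every
`v ∈ L²(ℝ³)` with a weak gradient `G` of finite dissipation and every level `j`,
`‖Δ̇_j v‖_{L²} ≤ C · 2^{−j} · (∫ |G|²)^{1/2}` (Danchin's reverse Bernstein inequality
`‖Δ̇_j W‖₂ ≲ 2^{−j} ∑ᵢ ‖Δ̇_j ∂ᵢ W‖₂` on the distribution `W` of `v`, `‖Δ̇_j ∂ᵢ W‖₂ ≲ ‖∂ᵢ W‖₂`, and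
`∂ᵢ W` = the distribution of the weak partial derivative `G·bᵢ`, whose `L²` norm is `≤ (∫|G|²)^{1/2}`;
the `L²` twin of the tree's `exists_eLpNorm_top_blockFn_le_two_rpow_mul_dissipation`). [cite: CheskidovShvydkoy2011, Lemma 4.1 (proof)] -/
theorem exists_eLpNorm_two_blockFn_le_two_rpow_neg_mul_dissipation :
    ∃ C : ℝ≥0, ∀ (j : ℕ) (v : EuclideanSpace ℝ (Fin 3) → EuclideanSpace ℝ (Fin 3))
      (G : EuclideanSpace ℝ (Fin 3) → EuclideanSpace ℝ (Fin 3) →L[ℝ] EuclideanSpace ℝ (Fin 3)),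
      MemLp v 2 volume → HasWeakGradient v G →
      (∫⁻ x, ENNReal.ofReal (frobeniusNormSq (G x))) < ∞ →
      eLpNorm (blockFn (j : ℤ) v) 2 volume ≤
        C * (2 : ℝ≥0∞) ^ (-(j : ℝ)) * (∫⁻ x, ENNReal.ofReal (frobeniusNormSq (G x))) ^ (1 / 2 : ℝ) := by
  classical
  set b := stdOrthonormalBasis ℝ (EuclideanSpace ℝ (Fin 3)) with hb
  obtain ⟨CR, hCR⟩ := exists_eLpNormDistrib_lpBlock_le_sum_lineDeriv
    (E := EuclideanSpace ℝ (Fin 3)) (F := EuclideanSpace ℂ (Fin 3)) 2 b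
  obtain ⟨CA, hCA⟩ := exists_eLpNormDistrib_lpBlock_le_eLpNormDistrib
    (E := EuclideanSpace ℝ (Fin 3)) (F := EuclideanSpace ℂ (Fin 3)) 2
  refine ⟨CR * (Fintype.card (Fin (Module.finrank ℝ (EuclideanSpace ℝ (Fin 3)))) * CA),
    fun j v G hv hG hD => ?_⟩
  -- the distribution of `v` and the dictionary for the `L²` block
  have hW := isDistributionOf_toTemperedDistribution (ι := Fin 3) hv
  set W : 𝓢'(EuclideanSpace ℝ (Fin 3), EuclideanSpace ℂ (Fin 3)) :=
    Lp.toTemperedDistribution ((memLp_complexify_comp hv).toLp _) with hWdef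
  have htwo : MemLp (blockFn (j : ℤ) v) 2 volume := memLp_blockFn (j : ℤ) hv one_le_two
  rw [← hW.eLpNormDistrib_lpBlock_eq hv (j : ℤ) htwo]
  -- the dissipation dominates each weak partial derivative in `L²`
  set D : ℝ≥0∞ := ∫⁻ x, ENNReal.ofReal (frobeniusNormSq (G x)) with hDdef
  have hGmeas : AEStronglyMeasurable G volume := hG.locallyIntegrable_grad.aestronglyMeasurable
  have hGi : ∀ i, eLpNorm (fun x => G x (b i)) 2 volume ≤ D ^ (1 / 2 : ℝ) := by
    intro i
    have hsq : eLpNorm (fun x => G x (b i)) 2 volume ^ 2 ≤ D := by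
      rw [eLpNorm_two_sq_eq_lintegral]
      refine lintegral_mono fun x => ?_
      rw [← ofReal_norm, ← ENNReal.ofReal_pow (norm_nonneg _)]
      exact ENNReal.ofReal_le_ofReal (norm_apply_sq_le_frobeniusNormSq b (G x) i)
    calc eLpNorm (fun x => G x (b i)) 2 volume
        = (eLpNorm (fun x => G x (b i)) 2 volume ^ 2) ^ (1 / 2 : ℝ) := by
          rw [← ENNReal.rpow_natCast, ← ENNReal.rpow_mul]; norm_num
      _ ≤ D ^ (1 / 2 : ℝ) := by gcongr
  have hGi_mem : ∀ i, MemLp (fun x => G x (b i)) 2 volume := by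
    intro i
    refine ⟨(ContinuousLinearMap.apply ℝ (EuclideanSpace ℝ (Fin 3)) (b i)).continuous.comp_aestronglyMeasurable hGmeas, ?_⟩
    exact (hGi i).trans_lt (ENNReal.rpow_lt_top_of_nonneg (by norm_num) hD.ne)
  -- `∂_{b i} W` is the distribution of `G · b i`, so its `L²` norm is that of `G · b i`
  have hder : ∀ i, eLpNormDistrib 2 (∂_{b i} W) = eLpNorm (fun x => G x (b i)) 2 volume := fun i =>
    (hW.lineDeriv_of_hasWeakGradient_of_memLp hG (b i) (hGi_mem i)).eLpNormDistrib_eq (hGi_mem i)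
  have hexp : (2 : ℝ≥0∞) ^ (-((j : ℤ) : ℝ)) = (2 : ℝ≥0∞) ^ (-(j : ℝ)) := by push_cast; rfl
  calc eLpNormDistrib 2 (lpBlock (j : ℤ) W)
      ≤ CR * (2 : ℝ≥0∞) ^ (-((j : ℤ) : ℝ)) * ∑ i, eLpNormDistrib 2 (lpBlock (j : ℤ) (∂_{b i} W)) := hCR _ W
    _ ≤ CR * (2 : ℝ≥0∞) ^ (-((j : ℤ) : ℝ)) *
          ∑ i : Fin (Module.finrank ℝ (EuclideanSpace ℝ (Fin 3))), CA * D ^ (1 / 2 : ℝ) := by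
        gcongr with i
        calc eLpNormDistrib 2 (lpBlock (j : ℤ) (∂_{b i} W))
            ≤ CA * eLpNormDistrib 2 (∂_{b i} W) := hCA _ _
          _ = CA * eLpNorm (fun x => G x (b i)) 2 volume := by rw [hder i]
          _ ≤ CA * D ^ (1 / 2 : ℝ) := by gcongr; exact hGi i
    _ = ((CR * (Fintype.card (Fin (Module.finrank ℝ (EuclideanSpace ℝ (Fin 3)))) * CA) : ℝ≥0) : ℝ≥0∞) *
          (2 : ℝ≥0∞) ^ (-(j : ℝ)) * D ^ (1 / 2 : ℝ) := by
        rw [Finset.sum_const, Finset.card_univ, hexp]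
        push_cast
        ring

/-! ### Tools -/

/-- `ofReal (C x) ≤ ofReal (max C 0) · ofReal x` for `x ≥ 0` (equality for `C ≥ 0`, and the left side
vanishes for `C ≤ 0`). [folklore] -/
theorem ofReal_mul_le_ofReal_max_mul {C x : ℝ} (hx : 0 ≤ x) :
    ENNReal.ofReal (C * x) ≤ ENNReal.ofReal (max C 0) * ENNReal.ofReal x := by
  rcases le_or_gt C 0 with hC | hC
  · rw [ENNReal.ofReal_of_nonpos (mul_nonpos_of_nonpos_of_nonneg hC hx)]
    exact bot_le
  · rw [max_eq_left hC.le, ENNReal.ofReal_mul hC.le]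

/-- In `[0,∞]`, `2^Q · 2^{−Q} = 1`. [folklore] -/
theorem two_pow_mul_two_rpow_neg (Q : ℕ) : (2 : ℝ≥0∞) ^ Q * (2 : ℝ≥0∞) ^ (-(Q : ℝ)) = 1 := by
  rw [← ENNReal.rpow_natCast, ← ENNReal.rpow_add _ _ (by norm_num) (by norm_num)]
  simp

/-- **The top saturated level.** If `Λ(v) < ∞` and some level is saturated, there is a FRONTIER level
`Q` (saturated, nothing saturated above it) with `Λ(v) ≤ 2^Q`. [cite: CheskidovShvydkoy2011, §3 (definition of Λ)] -/
theorem exists_frontierLevel {c₀ ν : ℝ} {v : EuclideanSpace ℝ (Fin 3) → EuclideanSpace ℝ (Fin 3)}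
    (hfin : dissipationWavenumber c₀ ν v < ∞) (hsat : ∃ j : ℕ, IsSaturatedLevel c₀ ν v j) :
    ∃ Q : ℕ, (IsSaturatedLevel c₀ ν v Q ∧ ∀ k : ℕ, Q < k → ¬ IsSaturatedLevel c₀ ν v k) ∧
      dissipationWavenumber c₀ ν v ≤ (2 : ℝ≥0∞) ^ Q := by
  classical
  obtain ⟨n, hn⟩ := (dissipationWavenumber_lt_top_iff c₀ ν v).1 hfin
  obtain ⟨j₀, hj₀⟩ := hsat
  -- every saturated level is `≤ n`
  have hbdd : ∀ j : ℕ, IsSaturatedLevel c₀ ν v j → j ≤ n := fun j hj =>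
    not_lt.1 fun hnj => hn j hnj hj
  set Q := Nat.findGreatest (fun j => IsSaturatedLevel c₀ ν v j) n with hQ
  have hQsat : IsSaturatedLevel c₀ ν v Q := Nat.findGreatest_spec (hbdd j₀ hj₀) hj₀
  have hQtop : ∀ k : ℕ, Q < k → ¬ IsSaturatedLevel c₀ ν v k := by
    intro k hQk hk
    exact Nat.findGreatest_is_greatest hQk (hbdd k hk) hk
  refine ⟨Q, ⟨hQsat, hQtop⟩, dissipationWavenumber_le (one_le_pow₀ one_le_two) fun j hj => ?_⟩
  exact pow_le_pow_right₀ one_le_two (not_lt.1 fun hQj => hQtop j hQj hj)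

/-! ### The stub -/

/-- **Frontier `L²` a-priori bound** (registered stub `stub_frontierL2Apriori` of the first-prover skeleton
for `NoThinFrontierBlowup`, stmt-NavierStokesRegularity-27233): for a threshold `0 < c₀ ≤ 1`, a Leray–Hopf
solution `u` of the unforced system on `ℝ³ × [0,T)` (`ν > 0`; the classical-solution hypothesis is idle)
and `0 ≤ t₀ < T`, if every frontier level of every slice `u t`, `t ∈ (t₀,T)`, is 1-thin with constant `C`
(`‖Δ̇_j u(t)‖_∞ ≤ C 2^{(3−1)j/2} ‖Δ̇_j u(t)‖₂`), then `∫_{t₀}^T Λ_{c₀,ν}(u(t))² dt < ∞` (thin Bernstein step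
`‖Δ̇_Q u‖₂ ≥ c₀ν/C`, reverse Bernstein `4^Q‖Δ̇_Q u‖₂² ≲ ‖∇u‖₂²`, energy inequality).
[cite: CheskidovShvydkoy2011, Lemma 4.1 (proof)] -/
theorem stub_frontierL2Apriori :
    ∀ c₀ : ℝ, 0 < c₀ → c₀ ≤ 1 → ∀ (ν T : ℝ), 0 < ν → 0 < T → ∀ (u : ℝ → EuclideanSpace ℝ (Fin 3) → EuclideanSpace ℝ (Fin 3)) (p : ℝ → EuclideanSpace ℝ (Fin 3) → ℝ), Literature.Analysis.FluidPDE.IsClassicalNSSolutionOn (Set.Ico 0 T) ν 0 u p → Literature.Analysis.FluidPDE.IsLerayHopfOn T ν 0 (u 0) u → ∀ C t₀ : ℝ, 0 ≤ t₀ → t₀ < T → (∀ t ∈ Set.Ioo t₀ T, ∀ j : ℕ, (Literature.Analysis.FluidPDE.IsSaturatedLevel c₀ ν (u t) j ∧ ∀ k : ℕ, j < k → ¬ Literature.Analysis.FluidPDE.IsSaturatedLevel c₀ ν (u t) k) → MeasureTheory.eLpNorm (Literature.Analysis.FunctionSpaces.blockFn (j : ℤ) (u t)) ⊤ MeasureTheory.volume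 ≤ ENNReal.ofReal (C * (2 : ℝ) ^ ((3 - (1 : ℝ)) / 2 * (j : ℝ))) * MeasureTheory.eLpNorm (Literature.Analysis.FunctionSpaces.blockFn (j : ℤ) (u t)) 2 MeasureTheory.volume) → (∫⁻ t in Set.Ioo t₀ T, Literature.Analysis.FluidPDE.dissipationWavenumber c₀ ν (u t) ^ 2) < ⊤ := by
  intro c₀ hc₀ _hc₁ ν T hν hT u p _hcl hLH C t₀ ht₀ _ht₀T hthin
  classical
  obtain ⟨C₂, hC₂⟩ := exists_eLpNorm_two_blockFn_le_two_rpow_neg_mul_dissipation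
  obtain ⟨m, G, hmeas, hae, hm⟩ := hLH.exists_measurable_dissipation hν hT
  have hΛ := hLH.ae_dissipationWavenumber_lt_top hc₀ hν hT
  -- constants
  set a : ℝ≥0∞ := ENNReal.ofReal (c₀ * ν) with ha
  have ha0 : a ≠ 0 := by rw [ha, Ne, ENNReal.ofReal_eq_zero, not_le]; exact mul_pos hc₀ hν
  have hatop : a ≠ ∞ := ENNReal.ofReal_ne_top
  set B : ℝ≥0∞ := ENNReal.ofReal (max C 0) * C₂ with hB
  have hBtop : B ≠ ∞ := ENNReal.mul_ne_top ENNReal.ofReal_ne_top ENNReal.coe_ne_top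
  set K : ℝ≥0∞ := B ^ 2 / a ^ 2 with hK
  have hKtop : K ≠ ∞ := ENNReal.div_ne_top (ENNReal.pow_ne_top hBtop) (pow_ne_zero _ ha0)
  -- pointwise a.e. bound on `(0,T)`: `Λ(u t)² ≤ 1 + K · m t`
  have hpt : ∀ᵐ t ∂(volume.restrict (Ioo 0 T)), t ∈ Ioo t₀ T →
      dissipationWavenumber c₀ ν (u t) ^ 2 ≤ 1 + K * m t := by
    filter_upwards [hae, hΛ, ae_restrict_mem measurableSet_Ioo] with t ht hΛt htI htI'
    obtain ⟨hGt, hmt, hfin⟩ := ht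
    have hv : MemLp (u t) 2 volume := hLH.memLp t (Ioo_subset_Icc_self htI)
    by_cases hsat : ∃ j : ℕ, IsSaturatedLevel c₀ ν (u t) j
    · -- a top saturated level `Q` exists; it is a frontier level, hence thin
      obtain ⟨Q, hQfr, hΛle⟩ := exists_frontierLevel hΛt hsat
      have hth := hthin t htI' Q hQfr
      have hD : (∫⁻ x, ENNReal.ofReal (frobeniusNormSq (G t x))) < ∞ := by rw [hmt]; exact hfin
      have hrev := hC₂ Q (u t) (G t) hv hGt hD
      rw [hmt] at hrev
      -- the thin constant: `ofReal (C 2^{(3-1)Q/2}) ≤ ofReal (max C 0) · 2^Q`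
      have hexp : (2 : ℝ) ^ ((3 - (1 : ℝ)) / 2 * (Q : ℝ)) = (2 : ℝ) ^ Q := by
        rw [show (3 - (1 : ℝ)) / 2 * (Q : ℝ) = (Q : ℝ) by ring, Real.rpow_natCast]
      have hthinC : ENNReal.ofReal (C * (2 : ℝ) ^ ((3 - (1 : ℝ)) / 2 * (Q : ℝ))) ≤
          ENNReal.ofReal (max C 0) * (2 : ℝ≥0∞) ^ Q := by
        rw [hexp]
        refine (ofReal_mul_le_ofReal_max_mul (by positivity)).trans (le_of_eq ?_)
        rw [ENNReal.ofReal_pow (by norm_num : (0 : ℝ) ≤ 2) Q, ENNReal.ofReal_ofNat]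
      -- chain: `a · 2^Q ≤ ‖Δ̇_Q u‖_∞ ≤ thin · ‖Δ̇_Q u‖₂ ≤ B · m^{1/2}`
      have hchain : a * 2 ^ Q ≤ B * m t ^ (1 / 2 : ℝ) := by
        calc a * 2 ^ Q ≤ eLpNorm (blockFn (Q : ℤ) (u t)) ∞ volume := hQfr.1
          _ ≤ ENNReal.ofReal (C * (2 : ℝ) ^ ((3 - (1 : ℝ)) / 2 * (Q : ℝ))) *
                eLpNorm (blockFn (Q : ℤ) (u t)) 2 volume := hth
          _ ≤ (ENNReal.ofReal (max C 0) * (2 : ℝ≥0∞) ^ Q) *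
                (C₂ * (2 : ℝ≥0∞) ^ (-(Q : ℝ)) * m t ^ (1 / 2 : ℝ)) := mul_le_mul' hthinC hrev
          _ = ENNReal.ofReal (max C 0) * C₂ * ((2 : ℝ≥0∞) ^ Q * (2 : ℝ≥0∞) ^ (-(Q : ℝ))) *
                m t ^ (1 / 2 : ℝ) := by ring
          _ = B * m t ^ (1 / 2 : ℝ) := by rw [two_pow_mul_two_rpow_neg, mul_one]
      have hΛB : a * dissipationWavenumber c₀ ν (u t) ≤ B * m t ^ (1 / 2 : ℝ) :=
        (mul_le_mul' le_rfl hΛle).trans hchain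
      -- square: `a² Λ² ≤ B² m`
      have hmsq : (m t ^ (1 / 2 : ℝ)) ^ 2 = m t := by
        rw [← ENNReal.rpow_natCast, ← ENNReal.rpow_mul]; norm_num
      have hsq : dissipationWavenumber c₀ ν (u t) ^ 2 * a ^ 2 ≤ B ^ 2 * m t := by
        calc dissipationWavenumber c₀ ν (u t) ^ 2 * a ^ 2 = (a * dissipationWavenumber c₀ ν (u t)) ^ 2 := by ring
          _ ≤ (B * m t ^ (1 / 2 : ℝ)) ^ 2 := pow_le_pow_left' hΛB 2
          _ = B ^ 2 * m t := by rw [mul_pow, hmsq]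
      have hdiv : dissipationWavenumber c₀ ν (u t) ^ 2 ≤ B ^ 2 * m t / a ^ 2 :=
        (ENNReal.le_div_iff_mul_le (Or.inl (pow_ne_zero _ ha0))
          (Or.inl (ENNReal.pow_ne_top hatop))).2 hsq
      have hKm : B ^ 2 * m t / a ^ 2 = K * m t := by
        rw [hK, div_eq_mul_inv, div_eq_mul_inv, mul_right_comm]
      calc dissipationWavenumber c₀ ν (u t) ^ 2 ≤ K * m t := by rw [← hKm]; exact hdiv
        _ ≤ 1 + K * m t := le_add_self
    · -- no saturated level: `Λ = 1`
      push Not at hsat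
      have hle : dissipationWavenumber c₀ ν (u t) ≤ 1 :=
        dissipationWavenumber_le le_rfl fun j hj => absurd hj (hsat j)
      calc dissipationWavenumber c₀ ν (u t) ^ 2 ≤ 1 ^ 2 := pow_le_pow_left' hle 2
        _ = 1 := one_pow 2
        _ ≤ 1 + K * m t := le_self_add
  -- restrict to `(t₀,T) ⊆ (0,T)`
  have hsub : Ioo t₀ T ⊆ Ioo 0 T := Ioo_subset_Ioo_left ht₀
  have hpt' : ∀ᵐ t ∂(volume.restrict (Ioo t₀ T)),
      dissipationWavenumber c₀ ν (u t) ^ 2 ≤ 1 + K * m t := by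
    have h1 : ∀ᵐ t ∂(volume.restrict (Ioo t₀ T)), t ∈ Ioo t₀ T →
        dissipationWavenumber c₀ ν (u t) ^ 2 ≤ 1 + K * m t :=
      ae_restrict_of_ae_restrict_of_subset hsub hpt
    filter_upwards [h1, ae_restrict_mem measurableSet_Ioo] with t h ht
    exact h ht
  -- integrate
  have hmI : ∫⁻ t in Ioo t₀ T, m t ≤ ENNReal.ofReal (VectorCalculus.kineticEnergy (u 0) / ν) :=
    (lintegral_mono_set hsub).trans hm
  calc (∫⁻ t in Ioo t₀ T, dissipationWavenumber c₀ ν (u t) ^ 2)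
      ≤ ∫⁻ t in Ioo t₀ T, (1 + K * m t) := lintegral_mono_ae hpt'
    _ = (∫⁻ _ in Ioo t₀ T, (1 : ℝ≥0∞)) + ∫⁻ t in Ioo t₀ T, K * m t := lintegral_add_left measurable_const _
    _ = ENNReal.ofReal (T - t₀) + K * ∫⁻ t in Ioo t₀ T, m t := by
        rw [setLIntegral_const, Real.volume_Ioo, one_mul, lintegral_const_mul' _ _ hKtop]
    _ ≤ ENNReal.ofReal (T - t₀) + K * ENNReal.ofReal (VectorCalculus.kineticEnergy (u 0) / ν) := by
        gcongr
    _ < ⊤ := ENNReal.add_lt_top.2 ⟨ENNReal.ofReal_lt_top,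
        ENNReal.mul_lt_top hKtop.lt_top ENNReal.ofReal_lt_top⟩

end Summit.NavierStokesRegularity.NavierStokesRegularity.Theorems.NoThinFrontierBlowup

end
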